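import Mathlib
import Summits.ResolutionOfSingularities.ResolutionOfSingularities.Theorems.HomologicalConductorPersistenceKC3UpperIdeal
import Literature.AlgebraicGeometry.Resolution.OriginLocalRing
import Literature.RingTheory.CohomologyAnnihilator.Localization
import HarnessLib

/-!
# Crux `Persistence` (stmt-ResolutionOfSingularities-16484) — w44b K-C3, K2-UPPER AT THE LOCAL RING (fact-free):
# `caᵐ(k[x,y,z,t]_𝔪 ⧸ (xy − z³ − t⁴)) ⊆ (x, y, z², zt, t²)` for every `m` and every field `k`

Route `ResolutionOfSingularities/HomologicalConductor`, chain W4.4b (cell `res-hironaka`), crux `Persistence`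
(stmt-ResolutionOfSingularities-16484), KILL CANDIDATE K-C3 (CHAIN w44b v13.2 §V13.10), item K2 («`ca(T₀) = I·T₀`»): the
UPPER HALF at the LOCAL stage `T₀`, in the tree's local model `k[x,y,z,t]_𝔪 ⧸ (f)`, `𝔪` = the origin
(`Literature…Resolution.originIdeal`, `OriginLocalization`), `f = X 0 * X 1 − X 2 ^ 3 − X 3 ^ 4`. res-L1-w44b-plan-1
«§6 local instance: GO res-type-010» (2026-08-27T11:44:56Z), typed by res-type-010. OURS; nothing here is a statement of the
manuscript under review (Hironaka 2017) and no statement of that manuscript is used; AI-written, weaker than expert review.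
Filed `--supports stmt-ResolutionOfSingularities-16484 --as helper`.

ROUTE (the engine of `…KC3Upper` p527657 at the local data): `S = k[z,t]_𝔪`, `S′ = k[x,y,z,t]_Q` (`Q` a prime carried as a
variable with `hQ : Q = originIdeal k 4`, so that consumers may take `Q := P.comap mk` literally), `ι, π` the localised
inclusion / retraction (`Localization.localRingHom`), test map `τ : k[z,t]_𝔪 → k⟦T⟧`, `z ↦ −T⁴`, `t ↦ T³`
(`IsLocalization.lift`: a polynomial with non-zero constant term becomes a unit of `k⟦T⟧`); the «all elements» closure:
every class is `p̄ · unit` with `p` a POLYNOMIAL, `p = ι(π p) + b`, `b ∈ (x, y)` (affine `sub_inclusion_retraction_mem`,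
p528919), `x̄, ȳ ∈ ca⁴` at the local ring from the affine K1 by Iyengar–Takahashi Lemma 2.10 (1)
(`map_cohomologyAnnihilatorOfDegree_le_of_isLocalization`), and the COEFFICIENT LEMMA `mem_J_of_test_mem` (p528919) after
`T⁶ ∣ τ p` in `k⟦T⟧` ⇒ `X⁶ ∣ τ p` in `k[T]`.

* §1 constant coefficients under the affine maps (`constantCoeff_aeval_of_forall`, `coeff_zero_aeval_of_forall`);
* §2 the local data: `originIdeal_two_eq_comap_inclusion`, `originIdeal_four_eq_comap_retraction`, `isUnit_test_of_mem_primeCompl`,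
  `coe_mem_span_X_pow_iff`;
* §3 **`mk_inclusion_not_mem_cohomologyAnnihilatorOfDegree_local`** — for a polynomial `c ∈ k[z,t]` with `c(−T⁴,T³) ∉ (T⁶)`,
  the class of `ι c` is outside `caᵐ(k[X]_Q ⧸ (f))` for every `m`; in particular `z̄, t̄` and every non-zero `λ z̄ + μ t̄`;
* §4 **`cohomologyAnnihilatorOfDegree_le_map_I_local`** — `caᵐ(k[X]_Q ⧸ (f)) ≤ (x, y, z², zt, t²)` for every `m`;
  `cohomologyAnnihilator_le_map_I_local`.
NOT here: the identification of the route's `T₀ = loc O A ⊆ K` (KC3 SPELLING v1) with this model — shared with K2c.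
-/

noncomputable section

-- single-problem summit: the doubled namespace component `ResolutionOfSingularities` is forced
set_option linter.dupNamespace false

namespace Summit.ResolutionOfSingularities.ResolutionOfSingularities.Theorems.HomologicalConductor.KC3Upper

open MvPolynomial
open Literature.RingTheory.CohomologyAnnihilator
open Literature.AlgebraicGeometry.Resolution

universe u

/-! ## §1 Constant coefficients under substitutions without constant term -/

section ConstantCoeff

variable {R : Type u} [CommRing R] {σ σ' : Type*}

/-- If every `g i` has zero constant coefficient then `(p(g)).constantCoeff = p.constantCoeff`. [folklore] -/
theorem constantCoeff_aeval_of_forall (g : σ → MvPolynomial σ' R) (hg : ∀ i, constantCoeff (g i) = 0)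
    (p : MvPolynomial σ R) : constantCoeff (MvPolynomial.aeval g p) = constantCoeff p := by
  induction p using MvPolynomial.induction_on with
  | C a => simp only [MvPolynomial.aeval_C, MvPolynomial.algebraMap_eq, MvPolynomial.constantCoeff_C]
  | add p q hp hq => simp only [map_add, hp, hq]
  | mul_X p i hp => simp only [map_mul, MvPolynomial.aeval_X, hp, hg, MvPolynomial.constantCoeff_X, mul_zero]

/-- If every `g i ∈ R[T]` has zero constant coefficient then `(p(g)).coeff 0 = p.constantCoeff`. [folklore] -/
theorem coeff_zero_aeval_of_forall (g : σ → Polynomial R) (hg : ∀ i, (g i).coeff 0 = 0)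
    (p : MvPolynomial σ R) : (MvPolynomial.aeval g p).coeff 0 = constantCoeff p := by
  induction p using MvPolynomial.induction_on with
  | C a => simp only [MvPolynomial.aeval_C, Polynomial.algebraMap_eq, Polynomial.coeff_C_zero,
      MvPolynomial.constantCoeff_C]
  | add p q hp hq => simp only [map_add, Polynomial.coeff_add, hp, hq]
  | mul_X p i hp => simp only [map_mul, MvPolynomial.aeval_X, Polynomial.mul_coeff_zero, hp, hg,
      MvPolynomial.constantCoeff_X, mul_zero]

end ConstantCoeff

/-! ## §2 The local data at the origin -/

section LocalData

variable (k : Type u) [Field k]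

/-- The inclusion `ι : k[z,t] → k[x,y,z,t]` pulls the origin back to the origin. [folklore] -/
theorem originIdeal_two_eq_comap_inclusion :
    originIdeal k 2 = (originIdeal k 4).comap
      (MvPolynomial.aeval (![X 2, X 3] : Fin 2 → MvPolynomial (Fin 4) k)).toRingHom := by
  ext p
  rw [Ideal.mem_comap, mem_originIdeal_iff, mem_originIdeal_iff, AlgHom.toRingHom_eq_coe, RingHom.coe_coe,
    constantCoeff_aeval_of_forall]
  intro i; fin_cases i <;> simp

/-- The retraction `π : k[x,y,z,t] → k[z,t]` (`x, y ↦ 0`) pulls the origin back to the origin. [folklore] -/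
theorem originIdeal_four_eq_comap_retraction :
    originIdeal k 4 = (originIdeal k 2).comap
      (MvPolynomial.aeval (![0, 0, X 0, X 1] : Fin 4 → MvPolynomial (Fin 2) k)).toRingHom := by
  ext p
  rw [Ideal.mem_comap, mem_originIdeal_iff, mem_originIdeal_iff, AlgHom.toRingHom_eq_coe, RingHom.coe_coe,
    constantCoeff_aeval_of_forall]
  intro i; fin_cases i <;> simp

/-- The test map `τ : k[z,t] → k⟦T⟧`, `z ↦ −T⁴`, `t ↦ T³`, sends polynomials with non-zero constant term to units.
[folklore] -/
theorem isUnit_test_of_mem_primeCompl (s : (originIdeal k 2).primeCompl) :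
    IsUnit (((Polynomial.coeToPowerSeries.ringHom : Polynomial k →+* PowerSeries k).comp
      (MvPolynomial.aeval (R := k) (![-(Polynomial.X ^ 4), Polynomial.X ^ 3] : Fin 2 → Polynomial k)).toRingHom)
        (s : MvPolynomial (Fin 2) k)) := by
  rw [PowerSeries.isUnit_iff_constantCoeff]
  have hs : constantCoeff (s : MvPolynomial (Fin 2) k) ≠ 0 := by
    have h := s.2
    rw [Ideal.mem_primeCompl_iff, mem_originIdeal_iff] at h
    exact h
  have hc : PowerSeries.constantCoeff
      (((Polynomial.coeToPowerSeries.ringHom : Polynomial k →+* PowerSeries k).comp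
        (MvPolynomial.aeval (R := k) (![-(Polynomial.X ^ 4), Polynomial.X ^ 3] : Fin 2 → Polynomial k)).toRingHom)
          (s : MvPolynomial (Fin 2) k)) = constantCoeff (s : MvPolynomial (Fin 2) k) := by
    rw [RingHom.comp_apply, Polynomial.coeToPowerSeries.ringHom_apply, ← PowerSeries.coeff_zero_eq_constantCoeff_apply,
      Polynomial.coeff_coe, AlgHom.toRingHom_eq_coe, RingHom.coe_coe, coeff_zero_aeval_of_forall]
    intro i; fin_cases i <;> simp
  rw [hc]
  exact isUnit_iff_ne_zero.mpr hs

/-- A polynomial lies in `(T⁶)·k⟦T⟧` iff it lies in `(T⁶)·k[T]`. [folklore] -/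
theorem coe_mem_span_X_pow_iff (q : Polynomial k) (n : ℕ) :
    (q : PowerSeries k) ∈ Ideal.span ({PowerSeries.X ^ n} : Set (PowerSeries k)) ↔
      q ∈ Ideal.span ({Polynomial.X ^ n} : Set (Polynomial k)) := by
  rw [Ideal.mem_span_singleton, Ideal.mem_span_singleton, PowerSeries.X_pow_dvd_iff, Polynomial.X_pow_dvd_iff]
  simp only [Polynomial.coeff_coe]

end LocalData

/-! ## §3 The engine at the local ring: `ι c ∉ caᵐ(k[X]_Q ⧸ (f))` whenever `c(−T⁴, T³) ∉ (T⁶)` -/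

section Local

variable (k : Type u) [Field k]

/-- **The engine of `…KC3Upper` at the local stage (OURS · w44b K-C3 K2-upper local).** `Q` a prime of `k[x,y,z,t]` with
`Q = originIdeal k 4` (carried as `hQ`), `S′ = k[X]_Q`, `f = (X 0 * X 1 − X 2 ^ 3 − X 3 ^ 4)`; for every polynomial
`c ∈ k[z,t]` with `c(−T⁴, T³) ∉ (T⁶)` and every `m`, the class of `c(X 2, X 3)` lies OUTSIDE `caᵐ(k[X]_Q ⧸ (f))`.
[OURS · L1 w44b] -/
theorem mk_inclusion_not_mem_cohomologyAnnihilatorOfDegree_local (Q : Ideal (MvPolynomial (Fin 4) k)) [Q.IsPrime]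
    (hQ : Q = originIdeal k 4) (c : MvPolynomial (Fin 2) k)
    (hc : (MvPolynomial.aeval (R := k) (![-(Polynomial.X ^ 4), Polynomial.X ^ 3] : Fin 2 → Polynomial k)).toRingHom c ∉
      Ideal.span ({Polynomial.X ^ 6} : Set (Polynomial k))) (m : ℕ) :
    Ideal.Quotient.mk (Ideal.span {algebraMap (MvPolynomial (Fin 4) k) (Localization.AtPrime Q)
        (X 0 * X 1 - X 2 ^ 3 - X 3 ^ 4)})
      (algebraMap (MvPolynomial (Fin 4) k) (Localization.AtPrime Q)
        ((MvPolynomial.aeval (![X 2, X 3] : Fin 2 → MvPolynomial (Fin 4) k)) c)) ∉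
      cohomologyAnnihilatorOfDegree (Localization.AtPrime Q ⧸
        Ideal.span {algebraMap (MvPolynomial (Fin 4) k) (Localization.AtPrime Q) (X 0 * X 1 - X 2 ^ 3 - X 3 ^ 4)}) m := by
  subst hQ
  -- the affine maps
  set ι₀ : MvPolynomial (Fin 2) k →+* MvPolynomial (Fin 4) k :=
    (MvPolynomial.aeval (![X 2, X 3] : Fin 2 → MvPolynomial (Fin 4) k)).toRingHom with hι₀
  set π₀ : MvPolynomial (Fin 4) k →+* MvPolynomial (Fin 2) k :=
    (MvPolynomial.aeval (![0, 0, X 0, X 1] : Fin 4 → MvPolynomial (Fin 2) k)).toRingHom with hπ₀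
  set τ₁ : MvPolynomial (Fin 2) k →+* PowerSeries k :=
    (Polynomial.coeToPowerSeries.ringHom : Polynomial k →+* PowerSeries k).comp
      (MvPolynomial.aeval (R := k) (![-(Polynomial.X ^ 4), Polynomial.X ^ 3] : Fin 2 → Polynomial k)).toRingHom with hτ₁
  -- the local rings and maps
  set S₂ := Localization.AtPrime (originIdeal k 2)
  set S₄ := Localization.AtPrime (originIdeal k 4)
  let ιL : S₂ →+* S₄ := Localization.localRingHom (originIdeal k 2) (originIdeal k 4) ι₀
    (originIdeal_two_eq_comap_inclusion k)
  let πL : S₄ →+* S₂ := Localization.localRingHom (originIdeal k 4) (originIdeal k 2) π₀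
    (originIdeal_four_eq_comap_retraction k)
  let τL : S₂ →+* PowerSeries k :=
    IsLocalization.lift (M := (originIdeal k 2).primeCompl) (g := τ₁) (isUnit_test_of_mem_primeCompl k)
  -- `π ∘ ι = id`
  have hπι : ∀ s : S₂, πL (ιL s) = s := by
    have hcomp : πL.comp ιL = RingHom.id S₂ := by
      refine IsLocalization.ringHom_ext (originIdeal k 2).primeCompl (RingHom.ext fun p => ?_)
      simp only [RingHom.comp_apply, RingHom.id_apply, ιL, πL]
      rw [Localization.localRingHom_to_map, Localization.localRingHom_to_map]
      congr 1
      exact retraction_comp_inclusion k p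
    intro s
    exact RingHom.congr_fun hcomp s
  -- the test values
  have hz : τL (algebraMap (MvPolynomial (Fin 2) k) S₂ (X 0)) = -PowerSeries.X ^ 4 := by
    rw [IsLocalization.lift_eq]
    simp [hτ₁, Polynomial.coe_X, Polynomial.coe_pow]
  have ht : τL (algebraMap (MvPolynomial (Fin 2) k) S₂ (X 1)) = PowerSeries.X ^ 3 := by
    rw [IsLocalization.lift_eq]
    simp [hτ₁, Polynomial.coe_X, Polynomial.coe_pow]
  have hx : πL (algebraMap (MvPolynomial (Fin 4) k) S₄ (X 0)) = 0 := by
    simp only [πL]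
    rw [Localization.localRingHom_to_map]
    simp [hπ₀]
  have hy : πL (algebraMap (MvPolynomial (Fin 4) k) S₄ (X 1)) = 0 := by
    simp only [πL]
    rw [Localization.localRingHom_to_map]
    simp [hπ₀]
  -- `f = x y − ι(z³ + t⁴)` and `f ∈ S₄⁰`
  have hιpow : ιL (algebraMap (MvPolynomial (Fin 2) k) S₂ (X 0) ^ 3 + algebraMap (MvPolynomial (Fin 2) k) S₂ (X 1) ^ 4) =
      algebraMap (MvPolynomial (Fin 4) k) S₄ (X 2 ^ 3 + X 3 ^ 4) := by
    rw [← map_pow, ← map_pow, ← map_add]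
    simp only [ιL]
    rw [Localization.localRingHom_to_map]
    congr 1
    simp [hι₀]
  have hfe : algebraMap (MvPolynomial (Fin 4) k) S₄ (X 0 * X 1 - X 2 ^ 3 - X 3 ^ 4) =
      algebraMap (MvPolynomial (Fin 4) k) S₄ (X 0) * algebraMap (MvPolynomial (Fin 4) k) S₄ (X 1) -
        ιL (algebraMap (MvPolynomial (Fin 2) k) S₂ (X 0) ^ 3 + algebraMap (MvPolynomial (Fin 2) k) S₂ (X 1) ^ 4) := by
    rw [hιpow, ← map_mul, ← map_sub]
    congr 1
    ring
  have hinj : Function.Injective (algebraMap (MvPolynomial (Fin 4) k) S₄) :=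
    IsLocalization.injective S₄ (originIdeal k 4).primeCompl_le_nonZeroDivisors
  have hf : algebraMap (MvPolynomial (Fin 4) k) S₄ (X 0 * X 1 - X 2 ^ 3 - X 3 ^ 4) ∈ nonZeroDivisors S₄ := by
    refine mem_nonZeroDivisors_of_ne_zero fun h => f_ne_zero k (hinj ?_)
    rw [h, map_zero]
  haveI : IsNoetherianRing S₄ := IsLocalization.isNoetherianRing (originIdeal k 4).primeCompl S₄ inferInstance
  -- the test value of `c`
  have hcL : τL (algebraMap (MvPolynomial (Fin 2) k) S₂ c) ∉ Ideal.span ({PowerSeries.X ^ 6} : Set (PowerSeries k)) := by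
    rw [IsLocalization.lift_eq, hτ₁, RingHom.comp_apply, Polynomial.coeToPowerSeries.ringHom_apply,
      coe_mem_span_X_pow_iff]
    exact hc
  have key := not_mem_cohomologyAnnihilatorOfDegree_of_map_not_mem ιL πL hπι τL (algebraMap (MvPolynomial (Fin 2) k) S₂ (X 0))
    (algebraMap (MvPolynomial (Fin 2) k) S₂ (X 1)) PowerSeries.X hz ht (algebraMap (MvPolynomial (Fin 4) k) S₄ (X 0)) (algebraMap (MvPolynomial (Fin 4) k) S₄ (X 1)) hx hy hfe hf hcL m
  have hιc : ιL (algebraMap (MvPolynomial (Fin 2) k) S₂ c) =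
      algebraMap (MvPolynomial (Fin 4) k) S₄ ((MvPolynomial.aeval (![X 2, X 3] : Fin 2 → MvPolynomial (Fin 4) k)) c) := by
    simp only [ιL]
    rw [Localization.localRingHom_to_map]
    rfl
  rw [hιc] at key
  exact key

/-- Contrapositive of the local engine: if the class of `c(X 2, X 3)` lies in some `caⁿ(k[X]_Q ⧸ (f))` then
`c(−T⁴, T³) ∈ (T⁶)`, hence (COEFFICIENT LEMMA p528919) `c ∈ J = (z², zt, t²)`. [OURS · L1 w44b] -/
theorem mem_J_of_mk_inclusion_mem_local (Q : Ideal (MvPolynomial (Fin 4) k)) [Q.IsPrime]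
    (hQ : Q = originIdeal k 4) (c : MvPolynomial (Fin 2) k) (n : ℕ)
    (h : Ideal.Quotient.mk (Ideal.span {algebraMap (MvPolynomial (Fin 4) k) (Localization.AtPrime Q)
        (X 0 * X 1 - X 2 ^ 3 - X 3 ^ 4)})
      (algebraMap (MvPolynomial (Fin 4) k) (Localization.AtPrime Q)
        ((MvPolynomial.aeval (![X 2, X 3] : Fin 2 → MvPolynomial (Fin 4) k)) c)) ∈
      cohomologyAnnihilatorOfDegree (Localization.AtPrime Q ⧸
        Ideal.span {algebraMap (MvPolynomial (Fin 4) k) (Localization.AtPrime Q) (X 0 * X 1 - X 2 ^ 3 - X 3 ^ 4)}) n) :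
    c ∈ Ideal.span ((fun s => monomial s (1 : k)) ''
        ({Finsupp.single 0 2, Finsupp.single 0 1 + Finsupp.single 1 1, Finsupp.single 1 2} :
          Set (Fin 2 →₀ ℕ))) := by
  refine mem_J_of_test_mem k c ?_
  by_contra hc
  exact mk_inclusion_not_mem_cohomologyAnnihilatorOfDegree_local k Q hQ c hc n h

/-! ## §4 The ideal bound at the local ring -/

/-- `x̄, ȳ ∈ ca⁴(k[X]_𝔪 ⧸ (f))`: the affine K1 memberships (`mk_X0_/mk_X1_mem_cohomologyAnnihilatorOfDegree_four`,
p528919 from res-D-pv-058's p522421) pushed to the localisation by Iyengar–Takahashi Lemma 2.10 (1), then moved from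
`k[X]_𝔪 ⧸ (f)·k[X]_𝔪` to `k[X]_𝔪 ⧸ (f)` along `Ideal.quotEquivOfEq`. [cite: IyengarTakahashi2014, Lemma 2.10 (1)] -/
theorem mk_algebraMap_mem_cohomologyAnnihilatorOfDegree_four_local {b : MvPolynomial (Fin 4) k}
    (hb : b ∈ Ideal.span ({X 0, X 1} : Set (MvPolynomial (Fin 4) k))) :
    Ideal.Quotient.mk (Ideal.span {algebraMap (MvPolynomial (Fin 4) k) (OriginLocalization k 4)
        (X 0 * X 1 - X 2 ^ 3 - X 3 ^ 4)})
      (algebraMap (MvPolynomial (Fin 4) k) (OriginLocalization k 4) b) ∈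
      cohomologyAnnihilatorOfDegree (OriginLocalization k 4 ⧸
        Ideal.span {algebraMap (MvPolynomial (Fin 4) k) (OriginLocalization k 4) (X 0 * X 1 - X 2 ^ 3 - X 3 ^ 4)}) 4 := by
  set f : MvPolynomial (Fin 4) k := X 0 * X 1 - X 2 ^ 3 - X 3 ^ 4 with hf
  set S₄ := OriginLocalization k 4
  -- affine: `mk b ∈ ca⁴(k[X] ⧸ (f))`
  have hb_aff : Ideal.Quotient.mk (Ideal.span {f}) b ∈
      cohomologyAnnihilatorOfDegree (MvPolynomial (Fin 4) k ⧸ Ideal.span {f}) 4 := by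
    have hle : (Ideal.span ({X 0, X 1} : Set (MvPolynomial (Fin 4) k))).map (Ideal.Quotient.mk (Ideal.span {f})) ≤
        cohomologyAnnihilatorOfDegree (MvPolynomial (Fin 4) k ⧸ Ideal.span {f}) 4 := by
      rw [Ideal.map_span, Ideal.span_le]
      rintro _ ⟨g, hg, rfl⟩
      simp only [Set.mem_insert_iff, Set.mem_singleton_iff] at hg
      rcases hg with rfl | rfl
      · exact mk_X0_mem_cohomologyAnnihilatorOfDegree_four k
      · exact mk_X1_mem_cohomologyAnnihilatorOfDegree_four k
    exact SetLike.le_def.mp hle (Ideal.mem_map_of_mem _ hb)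
  -- localise (Lemma 2.10 (1)) into `S₄ ⧸ (f)·S₄`
  have hloc := map_cohomologyAnnihilatorOfDegree_le_of_isLocalization
    (Algebra.algebraMapSubmonoid (MvPolynomial (Fin 4) k ⧸ Ideal.span {f}) (originIdeal k 4).primeCompl)
    (S₄ ⧸ (Ideal.span {f}).map (algebraMap (MvPolynomial (Fin 4) k) S₄)) 4
    (Ideal.mem_map_of_mem _ hb_aff)
  rw [Ideal.Quotient.algebraMap_quotient_map_quotient] at hloc
  -- move along `S₄ ⧸ (f)·S₄ = S₄ ⧸ (f)`
  have hmap : (Ideal.span {f}).map (algebraMap (MvPolynomial (Fin 4) k) S₄) =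
      Ideal.span {algebraMap (MvPolynomial (Fin 4) k) S₄ f} := by
    rw [Ideal.map_span, Set.image_singleton]
  have h2 := ringEquiv_apply_mem_cohomologyAnnihilatorOfDegree
    (R := S₄ ⧸ (Ideal.span {f}).map (algebraMap (MvPolynomial (Fin 4) k) S₄))
    (S := S₄ ⧸ Ideal.span {algebraMap (MvPolynomial (Fin 4) k) S₄ f}) (Ideal.quotEquivOfEq hmap) hloc
  rwa [Ideal.quotEquivOfEq_mk] at h2

/-- **K2-UPPER AT THE LOCAL RING (OURS · w44b K-C3): `caᵐ(k[x,y,z,t]_𝔪 ⧸ (xy − z³ − t⁴)) ≤ (x, y, z², zt, t²)` for every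
field `k` and every `m`**, in the model `Localization.AtPrime Q ⧸ (f)` for any prime `Q` with `Q = originIdeal k 4`
(instantiate `Q := originIdeal k 4`, or `Q := P.comap mk` to meet `localizationQuotientEquiv`). Fact-free. Proof: a class is
`p̄ · unit` with `p` a polynomial; `p = ι(π p) + b`, `b ∈ (x, y)`, `b̄ ∈ ca⁴`; so `ι(π p)‾ ∈ ca^{max(m,4)}`, the local engine
gives `(π p)(−T⁴, T³) ∈ (T⁶)`, the coefficient lemma gives `π p ∈ (z², zt, t²)`, hence `p ∈ I`. [OURS · L1 w44b] -/
theorem cohomologyAnnihilatorOfDegree_le_map_I_local (Q : Ideal (MvPolynomial (Fin 4) k)) [Q.IsPrime]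
    (hQ : Q = originIdeal k 4) (m : ℕ) :
    cohomologyAnnihilatorOfDegree (Localization.AtPrime Q ⧸
        Ideal.span {algebraMap (MvPolynomial (Fin 4) k) (Localization.AtPrime Q) (X 0 * X 1 - X 2 ^ 3 - X 3 ^ 4)}) m ≤
      ((Ideal.span ({X 0, X 1, X 2 ^ 2, X 2 * X 3, X 3 ^ 2} : Set (MvPolynomial (Fin 4) k))).map
          (algebraMap (MvPolynomial (Fin 4) k) (Localization.AtPrime Q))).map
        (Ideal.Quotient.mk (Ideal.span {algebraMap (MvPolynomial (Fin 4) k) (Localization.AtPrime Q)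
          (X 0 * X 1 - X 2 ^ 3 - X 3 ^ 4)})) := by
  subst hQ
  set f : MvPolynomial (Fin 4) k := X 0 * X 1 - X 2 ^ 3 - X 3 ^ 4 with hf
  set S₄ := Localization.AtPrime (originIdeal k 4)
  set I₀ : Ideal (MvPolynomial (Fin 4) k) := Ideal.span {X 0, X 1, X 2 ^ 2, X 2 * X 3, X 3 ^ 2} with hI₀
  set ι : MvPolynomial (Fin 2) k →ₐ[k] MvPolynomial (Fin 4) k := MvPolynomial.aeval ![X 2, X 3] with hι
  set π : MvPolynomial (Fin 4) k →ₐ[k] MvPolynomial (Fin 2) k := MvPolynomial.aeval ![0, 0, X 0, X 1] with hπ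
  intro u hu
  obtain ⟨a, rfl⟩ := Ideal.Quotient.mk_surjective u
  obtain ⟨p, s, hpsa⟩ := IsLocalization.exists_mk'_eq (originIdeal k 4).primeCompl a
  subst hpsa
  set N := max m 4 with hN
  -- reduce to the polynomial `p`
  have hps : IsLocalization.mk' S₄ p s = algebraMap (MvPolynomial (Fin 4) k) S₄ p * IsLocalization.mk' S₄ 1 s :=
    IsLocalization.mk'_eq_mul_mk'_one p s
  have hp_ca : Ideal.Quotient.mk (Ideal.span {algebraMap (MvPolynomial (Fin 4) k) S₄ f}) (algebraMap (MvPolynomial (Fin 4) k) S₄ p) ∈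
      cohomologyAnnihilatorOfDegree (S₄ ⧸ Ideal.span {algebraMap (MvPolynomial (Fin 4) k) S₄ f}) N := by
    have hsp : algebraMap (MvPolynomial (Fin 4) k) S₄ p = IsLocalization.mk' S₄ p s * algebraMap (MvPolynomial (Fin 4) k) S₄ (s : MvPolynomial (Fin 4) k) :=
      (IsLocalization.mk'_spec S₄ p s).symm
    rw [hsp, map_mul]
    exact Ideal.mul_mem_right _ _ (cohomologyAnnihilatorOfDegree_mono (le_max_left m 4) hu)
  -- `p = ι(π p) + b`, `b ∈ (x, y)`, `b̄ ∈ ca⁴ ⊆ ca^N`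
  have hb := sub_inclusion_retraction_mem k p
  have hbN : Ideal.Quotient.mk (Ideal.span {algebraMap (MvPolynomial (Fin 4) k) S₄ f}) (algebraMap (MvPolynomial (Fin 4) k) S₄ (p - ι (π p))) ∈
      cohomologyAnnihilatorOfDegree (S₄ ⧸ Ideal.span {algebraMap (MvPolynomial (Fin 4) k) S₄ f}) N :=
    cohomologyAnnihilatorOfDegree_mono (le_max_right m 4) (mk_algebraMap_mem_cohomologyAnnihilatorOfDegree_four_local k hb)
  have hιN : Ideal.Quotient.mk (Ideal.span {algebraMap (MvPolynomial (Fin 4) k) S₄ f}) (algebraMap (MvPolynomial (Fin 4) k) S₄ (ι (π p))) ∈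
      cohomologyAnnihilatorOfDegree (S₄ ⧸ Ideal.span {algebraMap (MvPolynomial (Fin 4) k) S₄ f}) N := by
    have h3 : algebraMap (MvPolynomial (Fin 4) k) S₄ p - algebraMap (MvPolynomial (Fin 4) k) S₄ (p - ι (π p)) = algebraMap (MvPolynomial (Fin 4) k) S₄ (ι (π p)) := by
      rw [← map_sub, sub_sub_cancel]
    have h4 := Ideal.sub_mem _ hp_ca hbN
    rw [← map_sub, h3] at h4
    exact h4
  -- the local engine + the coefficient lemma: `π p ∈ J`
  have hJ := mem_J_of_mk_inclusion_mem_local k (originIdeal k 4) rfl (π p) N hιN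
  -- hence `p ∈ I₀`
  have hIxy : Ideal.span ({X 0, X 1} : Set (MvPolynomial (Fin 4) k)) ≤ I₀ :=
    Ideal.span_mono (by intro g hg; simp only [Set.mem_insert_iff, Set.mem_singleton_iff] at hg ⊢; tauto)
  have hιp : ι (π p) ∈ I₀ := SetLike.le_def.mp (map_inclusion_J_le k) (Ideal.mem_map_of_mem _ hJ)
  have hpI : p ∈ I₀ := by
    have : p = ι (π p) + (p - ι (π p)) := by ring
    rw [this]
    exact Ideal.add_mem _ hιp (SetLike.le_def.mp hIxy hb)
  -- and `ū = p̄ · (1/s)‾ ∈ I₀·T`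
  rw [hps, map_mul]
  exact Ideal.mul_mem_right _ _ (Ideal.mem_map_of_mem _ (Ideal.mem_map_of_mem _ hpI))

/-- **`ca(k[x,y,z,t]_𝔪 ⧸ (xy − z³ − t⁴)) ≤ (x, y, z², zt, t²)`** for the full cohomology annihilator, every field `k`.
[OURS · L1 w44b] -/
theorem cohomologyAnnihilator_le_map_I_local (Q : Ideal (MvPolynomial (Fin 4) k)) [Q.IsPrime]
    (hQ : Q = originIdeal k 4) :
    cohomologyAnnihilator (Localization.AtPrime Q ⧸
        Ideal.span {algebraMap (MvPolynomial (Fin 4) k) (Localization.AtPrime Q) (X 0 * X 1 - X 2 ^ 3 - X 3 ^ 4)}) ≤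
      ((Ideal.span ({X 0, X 1, X 2 ^ 2, X 2 * X 3, X 3 ^ 2} : Set (MvPolynomial (Fin 4) k))).map
          (algebraMap (MvPolynomial (Fin 4) k) (Localization.AtPrime Q))).map
        (Ideal.Quotient.mk (Ideal.span {algebraMap (MvPolynomial (Fin 4) k) (Localization.AtPrime Q)
          (X 0 * X 1 - X 2 ^ 3 - X 3 ^ 4)})) := by
  intro a ha
  rw [mem_cohomologyAnnihilator_iff] at ha
  obtain ⟨m, hm⟩ := ha
  exact cohomologyAnnihilatorOfDegree_le_map_I_local k Q hQ m hm

/-- **`z̄ ∉ caᵐ` and `t̄ ∉ caᵐ` at the local ring** `k[x,y,z,t]_𝔪 ⧸ (xy − z³ − t⁴)`, every field `k`, every `m`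
(the two certificates of REFEREE-KC3 (γ) at `T₀`'s model). [OURS · L1 w44b] -/
theorem mk_z_t_not_mem_cohomologyAnnihilatorOfDegree_local (Q : Ideal (MvPolynomial (Fin 4) k)) [Q.IsPrime]
    (hQ : Q = originIdeal k 4) (m : ℕ) :
    Ideal.Quotient.mk (Ideal.span {algebraMap (MvPolynomial (Fin 4) k) (Localization.AtPrime Q)
        (X 0 * X 1 - X 2 ^ 3 - X 3 ^ 4)}) (algebraMap (MvPolynomial (Fin 4) k) (Localization.AtPrime Q) (X 2)) ∉
      cohomologyAnnihilatorOfDegree (Localization.AtPrime Q ⧸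
        Ideal.span {algebraMap (MvPolynomial (Fin 4) k) (Localization.AtPrime Q) (X 0 * X 1 - X 2 ^ 3 - X 3 ^ 4)}) m ∧
    Ideal.Quotient.mk (Ideal.span {algebraMap (MvPolynomial (Fin 4) k) (Localization.AtPrime Q)
        (X 0 * X 1 - X 2 ^ 3 - X 3 ^ 4)}) (algebraMap (MvPolynomial (Fin 4) k) (Localization.AtPrime Q) (X 3)) ∉
      cohomologyAnnihilatorOfDegree (Localization.AtPrime Q ⧸
        Ideal.span {algebraMap (MvPolynomial (Fin 4) k) (Localization.AtPrime Q) (X 0 * X 1 - X 2 ^ 3 - X 3 ^ 4)}) m := by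
  have hz := mk_inclusion_not_mem_cohomologyAnnihilatorOfDegree_local k Q hQ (X 0) ?_ m
  have ht := mk_inclusion_not_mem_cohomologyAnnihilatorOfDegree_local k Q hQ (X 1) ?_ m
  · simp only [MvPolynomial.aeval_X, Matrix.cons_val_zero, Matrix.cons_val_one] at hz ht
    exact ⟨hz, ht⟩
  · have h := lin_not_mem_span_X_pow_six k 0 1 (Or.inr one_ne_zero)
    simpa [Polynomial.algebraMap_eq] using h
  · have h := lin_not_mem_span_X_pow_six k 1 0 (Or.inl one_ne_zero)
    simpa [Polynomial.algebraMap_eq] using h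

end Local

end Summit.ResolutionOfSingularities.ResolutionOfSingularities.Theorems.HomologicalConductor.KC3Upper

end
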